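import Summits.BirchSwinnertonDyer.Rank1Residual.O5.CompanionTypeLawThreeOfModThreeTransport
import Summits.BirchSwinnertonDyer.Rank1Residual.Additive.AnomalousPointCountThree
import Summits.BirchSwinnertonDyer.BirchSwinnertonDyer.Theorems.Rank1ResidualIntModelReduction
import HarnessLib

/-!
# The third `L`-coefficient of a curve SEMISTABLE at `3` with `E[3]|G_{ℚ₃}` reducible is
# `c₃(G) ≡ −c₆(G) ≢ 0 (mod 3)` (route `CyclotomicUntwist`, K1 supply — O6 lane V10, step (M3) of
# the P-SHAPE-PARTNER law `Additive.CompanionShapeLawThree`; cell `bsd-wall`, seat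
# `bsd-line-cycu-p2` g5; THEOREMS ONLY)

For a globally minimal elliptic `G / ℚ` with `9 ∤ N_G` (semistable at `3`) whose `G[3]|G_{ℚ₃}`
is REDUCIBLE (`¬ LocIrr G 3`: good ordinary or multiplicative at `3`), with `c₃(G) = G.LFunction 3`
the third coefficient of `L(G, s)` (`a₃(G)` at good `3`, `+1` split / `−1` non-split):

* `intCast_c₆_zmod_three`, `intCast_c₄_zmod_three` — `c₆ ≡ −b₂` and `c₄ ≡ b₂²` `(mod 3)` for every
  integer Weierstrass equation (`c₆ = −b₂³ + 36b₂b₄ − 216b₆`, Fermat);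
* `exists_nodal_root_zmod_three_iff` — over `𝔽₃`, for `c₄ ≠ 0`, Mathlib's node-tangent quadratic
  `c₄T² + a₁c₄T − (54b₆ − 3b₂b₄ + a₂c₄) = c₄(T² + a₁T − a₂)` has a root iff its discriminant
  `b₂ = a₁² + 4a₂` is `1` (kernel decision on `(a₁, a₂)`);
* `lFunction_three_zmod_eq_b₂_of_multiplicative` — at a MULTIPLICATIVE `3` (`3 ∣ Δ_min`, `3 ∤ c₄`):
  `c₃(G) ≡ b₂ (mod 3)` (split iff `b₂ ≡ 1`, Silverman VII.5.1(b) via the tree's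
  `lFunction_prime_eq_of_dvd_of_not_dvd`); the good case `a₃ ≡ b₂` is the tree's
  `DeuringThree.intCast_frobeniusTrace_three_eq_b₂` (Hasse invariant at `3`);
* **`not_dvd_c₆_and_lFunction_three_eq_of_not_locIrr`** — `9 ∤ N_G`, `¬ LocIrr G 3` ⟹
  `3 ∤ c₆(G_ℤ)` and `(c₃(G) : ZMod 3) = −c₆(G_ℤ)`; i.e. `c₃ ≡ +1` iff `c₆ ≡ −1`, `c₃ ≡ −1` iff
  `c₆ ≡ +1` — the datum the sequel compares with the stable-line sign `F(x₀) = (−1/216)·c₆·(1 + O(3))`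
  of x11b3-p8's `stableLineSignThree_eq_c₆_mul`.

HONEST FRAMING: helper theorems; nothing about any particular curve is asserted; K1/K2 of the route
are neither proved nor reduced; BSD is not proved for any curve. References: J. H. Silverman, *AEC*
(2009) VII.5.1(b), §C.16, V.4.1(a) [SilvermanAEC2009]; J.-P. Serre, Invent. Math. 15 (1972) §1.11
Prop. 11 [Serre1972].
-/

set_option linter.dupNamespace false

noncomputable section

open scoped Classical

namespace Summit.BirchSwinnertonDyer.BirchSwinnertonDyer.Theorems.CompanionShape

open Polynomial WeierstrassCurve Literature.NumberTheory.EllipticCurves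
  Summit.BirchSwinnertonDyer.Rank1Residual.Additive Summit.BirchSwinnertonDyer.Rank1Residual
  Summit.BirchSwinnertonDyer.BirchSwinnertonDyer.Rank1Residual.IntModel

/-! ## §1 Integer identities modulo `3` -/

/-- `c₆ ≡ −b₂ (mod 3)` for every integer Weierstrass equation (`c₆ = −b₂³ + 36b₂b₄ − 216b₆` and
`b³ ≡ b`). [folklore] -/
theorem intCast_c₆_zmod_three (I₀ : WeierstrassCurve ℤ) :
    ((I₀.c₆ : ℤ) : ZMod 3) = -((I₀.b₂ : ℤ) : ZMod 3) := by
  have h36 : (36 : ZMod 3) = 0 := by decide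
  have h216 : (216 : ZMod 3) = 0 := by decide
  have hcube : ∀ b : ZMod 3, b ^ 3 = b := by decide
  simp only [WeierstrassCurve.c₆]
  push_cast
  rw [h36, h216, hcube]
  ring

/-- `c₄ ≡ b₂² (mod 3)` for every integer Weierstrass equation (`c₄ = b₂² − 24b₄`). [folklore] -/
theorem intCast_c₄_zmod_three (I₀ : WeierstrassCurve ℤ) :
    ((I₀.c₄ : ℤ) : ZMod 3) = ((I₀.b₂ : ℤ) : ZMod 3) ^ 2 := by
  have h24 : (24 : ZMod 3) = 0 := by decide
  simp only [WeierstrassCurve.c₄]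
  push_cast
  rw [h24]
  ring

/-- Over `𝔽₃`: for `c₄ ≠ 0` the node-tangent quadratic `c₄T² + a₁c₄T − (54b₆ − 3b₂b₄ + a₂c₄)`
(`= c₄(T² + a₁T − a₂)`) has a root iff `b₂ = 1` (its discriminant `a₁² + 4a₂ = b₂` is a non-zero
square). [cite: SilvermanAEC2009, VII.5 Prop. 5.1(b)] -/
theorem exists_nodal_root_zmod_three_iff (I : WeierstrassCurve (ZMod 3)) (hc₄ : I.c₄ ≠ 0) :
    (∃ t : ZMod 3, I.c₄ * t ^ 2 + I.a₁ * I.c₄ * t - (54 * I.b₆ - 3 * I.b₂ * I.b₄ + I.a₂ * I.c₄) = 0)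
      ↔ I.b₂ = 1 := by
  have h54 : (54 : ZMod 3) = 0 := by decide
  have h3 : (3 : ZMod 3) = 0 := by decide
  have h24 : (24 : ZMod 3) = 0 := by decide
  have hfac : ∀ t : ZMod 3, I.c₄ * t ^ 2 + I.a₁ * I.c₄ * t -
      (54 * I.b₆ - 3 * I.b₂ * I.b₄ + I.a₂ * I.c₄) = I.c₄ * (t ^ 2 + I.a₁ * t - I.a₂) := by
    intro t
    rw [h54, h3]
    ring
  have hb₂ : I.b₂ = I.a₁ ^ 2 + 4 * I.a₂ := rfl
  have hc₄b : I.c₄ = I.b₂ ^ 2 := by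
    rw [show I.c₄ = I.b₂ ^ 2 - 24 * I.b₄ from rfl, h24]
    ring
  have key : (∃ t : ZMod 3, I.c₄ * t ^ 2 + I.a₁ * I.c₄ * t -
      (54 * I.b₆ - 3 * I.b₂ * I.b₄ + I.a₂ * I.c₄) = 0) ↔ ∃ t : ZMod 3, t ^ 2 + I.a₁ * t - I.a₂ = 0 := by
    constructor
    · rintro ⟨t, ht⟩
      exact ⟨t, (mul_eq_zero.mp ((hfac t).symm.trans ht)).resolve_left hc₄⟩
    · rintro ⟨t, ht⟩
      exact ⟨t, by rw [hfac, ht, mul_zero]⟩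
  rw [key]
  have hb0 : I.b₂ ≠ 0 := fun h ↦ hc₄ (by rw [hc₄b, h, zero_pow two_ne_zero])
  rw [hb₂] at hb0 ⊢
  generalize I.a₁ = a at hb0 ⊢
  generalize I.a₂ = b at hb0 ⊢
  revert a b
  decide

/-! ## §2 The multiplicative case: split iff `b₂ ≡ 1 (mod 3)` -/

section Curve

variable (G : WeierstrassCurve ℚ) [G.IsElliptic] [G.IsGloballyMinimal]

/-- **`c₃(G) ≡ b₂ (mod 3)` at a multiplicative `3`** (`3 ∣ Δ_min`, `3 ∤ c₄` on the minimal model):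
`c₃ = +1` iff split iff the node-tangent quadratic mod `3` splits (tree
`lFunction_prime_eq_of_dvd_of_not_dvd`, Silverman §C.16 / VII.5.1(b)) iff `b₂ ≡ 1`; otherwise
`c₃ = −1` and `b₂ ≡ −1` (`b₂² ≡ c₄ ≢ 0`). [cite: SilvermanAEC2009, VII.5 Prop. 5.1(b) and §C.16] -/
theorem lFunction_three_zmod_eq_b₂_of_multiplicative (hΔ : (3 : ℤ) ∣ G.minimalDiscriminantInt)
    (hc₄ : ¬ (3 : ℤ) ∣ (integralModelInt G).c₄) :
    ((G.LFunction 3 : ℤ) : ZMod 3) = (((integralModelInt G).b₂ : ℤ) : ZMod 3) := by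
  set I := (integralModelInt G).map (Int.castRingHom (ZMod 3)) with hI
  have hIc₄ : I.c₄ = (((integralModelInt G).c₄ : ℤ) : ZMod 3) := by rw [hI, map_c₄, eq_intCast]
  have hIb₂ : I.b₂ = (((integralModelInt G).b₂ : ℤ) : ZMod 3) := by rw [hI, map_b₂, eq_intCast]
  have hc : I.c₄ ≠ 0 := by
    rw [hIc₄, Ne, ZMod.intCast_zmod_eq_zero_iff_dvd]
    exact hc₄
  have hdeg := degree_nodal_eq_two (integralModelInt G) 3 hc₄
  have hroot := exists_nodal_root_zmod_three_iff I hc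
  rw [G.lFunction_prime_eq_of_dvd_of_not_dvd 3 hΔ hc₄, ← hIb₂]
  split_ifs with hs
  · obtain ⟨t, ht⟩ := hs.exists_eval_eq_zero (by rw [hdeg]; decide)
    have h1 : I.b₂ = 1 := hroot.mp ⟨t, by
      simpa only [eval_sub, eval_add, eval_mul, eval_C, eval_X, eval_pow] using ht⟩
    rw [h1]
    push_cast
    rfl
  · have h1 : I.b₂ ≠ 1 := fun h1 ↦ hs (by
      obtain ⟨t, ht⟩ := hroot.mpr h1
      refine Splits.of_degree_eq_two hdeg (x := t) ?_
      simpa only [eval_sub, eval_add, eval_mul, eval_C, eval_X, eval_pow] using ht)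
    have h0 : I.b₂ ≠ 0 := fun h0 ↦ hc (by
      rw [hIc₄, intCast_c₄_zmod_three, ← hIb₂, h0, zero_pow two_ne_zero])
    have key : ∀ b : ZMod 3, b ≠ 0 → b ≠ 1 → b = -1 := by decide
    rw [key I.b₂ h0 h1]
    push_cast
    rfl

/-! ## §3 Semistable and locally reducible at `3`: `3 ∤ c₆` and `c₃ ≡ −c₆ (mod 3)` -/

/-- **(M3) `c₃(G) ≡ −c₆(G) ≢ 0 (mod 3)` for `G` semistable at `3` with `G[3]|G_{ℚ₃}` reducible.**
Good `3` (`3 ∤ Δ_min`): `c₃ = a₃ ≡ b₂` (Hasse invariant, `DeuringThree.intCast_frobeniusTrace_three_eq_b₂`)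
and reducible iff `3 ∤ a₃` (Serre 1972 §1.11, `locIrr_three_iff_dvd_frobeniusTrace_of_hasGoodReductionAtPrime`);
multiplicative `3`: §2; additive `3` is excluded by `9 ∤ N_G`
(`O5.nine_dvd_conductorNorm_of_three_dvd_of_three_dvd`). In both cases `c₆ ≡ −b₂³ ≡ −b₂`.
[cite: Serre1972, §1.11 Prop. 11] [cite: SilvermanAEC2009, VII.5 Prop. 5.1(b), §C.16, V.4.1(a)] -/
theorem not_dvd_c₆_and_lFunction_three_eq_of_not_locIrr (h9 : ¬ 9 ∣ G.conductorNorm ℤ)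
    (hred : ¬ LocIrr G 3) :
    ¬ (3 : ℤ) ∣ (integralModelInt G).c₆ ∧
      ((G.LFunction 3 : ℤ) : ZMod 3) = -(((integralModelInt G).c₆ : ℤ) : ZMod 3) := by
  have hb₂ : ((G.LFunction 3 : ℤ) : ZMod 3) = (((integralModelInt G).b₂ : ℤ) : ZMod 3) := by
    by_cases hΔ : (3 : ℤ) ∣ G.minimalDiscriminantInt
    · -- multiplicative (additive is excluded by `9 ∤ N_G`)
      have hc₄ : ¬ (3 : ℤ) ∣ (integralModelInt G).c₄ := fun hc₄ ↦
        h9 (O5.nine_dvd_conductorNorm_of_three_dvd_of_three_dvd G hΔ hc₄)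
      exact lFunction_three_zmod_eq_b₂_of_multiplicative G hΔ hc₄
    · -- good
      have hgood : G.HasGoodReductionAtPrime 3 := G.hasGoodReductionAtPrime_of_not_dvd 3 hΔ
      rw [G.LFunction_apply_prime_eq_frobeniusTrace 3 hgood]
      exact DeuringThree.intCast_frobeniusTrace_three_eq_b₂ G hΔ
  have hne : ((G.LFunction 3 : ℤ) : ZMod 3) ≠ 0 := by
    rw [Ne, ZMod.intCast_zmod_eq_zero_iff_dvd]
    intro h3
    exact hred ((O5.dvd_lFunction_three_iff_locIrr_three_of_not_nine_dvd_conductorNorm G h9).mp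
      (by exact_mod_cast h3))
  rw [intCast_c₆_zmod_three, neg_neg]
  refine ⟨fun h6 ↦ hne ?_, hb₂⟩
  rw [hb₂, ← neg_neg (((integralModelInt G).b₂ : ℤ) : ZMod 3), ← intCast_c₆_zmod_three,
    (ZMod.intCast_zmod_eq_zero_iff_dvd _ 3).mpr h6, neg_zero]

end Curve

end Summit.BirchSwinnertonDyer.BirchSwinnertonDyer.Theorems.CompanionShape

end
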